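import Summits.QuantumFields.YangMills.Theorems.LuscherReductionTwistedTraceScalingFloorSoftModes
import Summits.QuantumFields.YangMills.Theorems.LuscherReductionTwistedTraceScalingToronConstantModes
import Summits.QuantumFields.YangMills.Theorems.LuscherReductionTwistedTraceScalingToronZeroMode
import HarnessLib

/-!
# C4 INNER, brick G1: the STIFF SPACE at the classical vacuum — `Stiff = (ker D_1̄)ᗮ ⊂ LinkSpace L`, its coercivity `‖D_1̄ q‖² ≥ (2 − 2cos(2π/L))‖q‖²`,
# and the nine constant modes inside `ker D_1̄`
# (lane A of S-BASE, crux `TwistedTraceScaling` stmt-QuantumFields-20203; sub-target C4, design note `pub/ym-fleet/ym-luscher-20007-p1/COARSE-DESIGN.md` §21.5 G, §21.9 (1))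

The product chart `U = (constLift c · P(w))^g` of the inner region (§21.9) takes its stiff coordinate `w` in the orthogonal complement of the zero modes of the
vacuum curl `D_1̄ = covCurl 1 = latCurl` (the `3L³+6` zero modes = nine constant modes ⊕ linearised gauge modes).  This file fixes that space canonically and proves
the two facts the Gaussian analysis needs:
* §1 `ker_eq_of_isDiag` — in any diagonalising frame `(e,a)` of `D`: `v ∈ ker D ↔ ⟪eᵢ,v⟫ = 0` for every `i` with `aᵢ ≠ 0`; zero-value frame vectors lie in `ker D`;
* §2 `stiffSpace L := (LinearMap.ker (covCurl 1))ᗮ`; ★★ `stiff_coercive`: for `L ≥ 2` and `q ∈ stiffSpace L`, `(2 − 2cos(2π/L))·‖q‖² ≤ ‖covCurl 1 q‖²`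
  (the vacuum dichotomy `Frame.IsDiag.value_zero_or_ge_vacuum` + `norm_sq_ge_of_dichotomy`);
* §3 `constModes_le_ker_covCurl_one` — the nine constant modes are zero modes (`latCurl_constMode`), hence `constModes L ⟂ stiffSpace L`
  (`inner_eq_zero_of_mem_constModes_of_mem_stiff`); also the linearised gauge modes `latCurl_gradient`.
HONEST FRAMING: finite-dimensional linear algebra for a stub of a child of the CONDITIONAL reduction route (femto rung R2b1); not infinite volume, not a gap, not Clay.

## References
* M. Lüscher, Nucl. Phys. B219 (1983) 233, §3 (constant modes vs. the gapped non-constant modes). [Luscher1983]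
* R. A. Horn, C. R. Johnson, *Matrix Analysis* (2nd ed., 2013), Thm 4.1.5. [HornJohnson2013]
-/

set_option autoImplicit false

noncomputable section

open Finset Real Module
open scoped BigOperators InnerProductSpace RealInnerProductSpace
open Literature.MathematicalPhysics.QuantumFieldTheory
open Literature.MathematicalPhysics.QuantumLattice

namespace Summit.QuantumFields.YangMills.Theorems.FemtoTransferGap.TwoLattice.Toron

open Summit.QuantumFields.YangMills.Theorems.FemtoTransferGap
open Summit.QuantumFields.YangMills.Theorems.FemtoTransferGap.TwoLattice
open Summit.QuantumFields.YangMills.Theorems.FemtoTransferGap.TwoLattice.Stiff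
open Summit.QuantumFields.YangMills.Theorems.FemtoTransferGap.TwoLattice.Cov

/-! ## §1 The kernel of `D` in a diagonalising frame -/

section Abstract

variable {E F : Type*} [NormedAddCommGroup E] [InnerProductSpace ℝ E] [NormedAddCommGroup F] [InnerProductSpace ℝ F]
variable {ι : Type*} [Fintype ι] [DecidableEq ι]

/-- In a diagonalising frame: `D v = 0 ↔ ⟪eᵢ, v⟫ = 0` for all `i` with `aᵢ ≠ 0`. [cite: HornJohnson2013, Thm 4.1.5] -/
theorem apply_eq_zero_iff_of_isDiag {D : E →ₗ[ℝ] F} {e : OrthonormalBasis ι ℝ E} {a : ι → ℝ} (h : Frame.IsDiag D e a) (v : E) :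
    D v = 0 ↔ ∀ i, a i ≠ 0 → ⟪e i, v⟫_ℝ = 0 := by
  have hnorm := h.norm_sq_eq_sum_real v
  have hterm : ∀ i, 0 ≤ a i * ⟪e i, v⟫_ℝ ^ 2 := fun i => mul_nonneg (h.nonneg i) (sq_nonneg _)
  constructor
  · intro hv i hi
    rw [hv, norm_zero, sq, zero_mul] at hnorm
    have h0 : a i * ⟪e i, v⟫_ℝ ^ 2 = 0 := (Finset.sum_eq_zero_iff_of_nonneg (fun j _ => hterm j)).mp hnorm.symm i (Finset.mem_univ i)
    rcases mul_eq_zero.mp h0 with h | h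
    · exact absurd h hi
    · exact pow_eq_zero_iff (n := 2) (by norm_num) |>.mp h
  · intro hv
    have h0 : ‖D v‖ ^ 2 = 0 := by
      rw [hnorm]
      refine Finset.sum_eq_zero fun i _ => ?_
      by_cases hi : a i = 0
      · rw [hi, zero_mul]
      · rw [hv i hi]; ring
    have : ‖D v‖ = 0 := pow_eq_zero_iff (n := 2) (by norm_num) |>.mp h0
    exact norm_eq_zero.mp this

/-- Zero-value frame vectors are in the kernel. [folklore] -/
theorem frame_mem_ker_of_value_zero {D : E →ₗ[ℝ] F} {e : OrthonormalBasis ι ℝ E} {a : ι → ℝ} (h : Frame.IsDiag D e a) {i : ι} (hi : a i = 0) :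
    e i ∈ LinearMap.ker D := by
  rw [LinearMap.mem_ker]; exact h.apply_eq_zero_of_value hi

/-- ★ **Coercivity on the orthogonal complement of the kernel**: if the values satisfy the dichotomy `aᵢ = 0 ∨ m ≤ aᵢ`, then every `q ⟂ ker D` has
`m‖q‖² ≤ ‖D q‖²`. [cite: HornJohnson2013, Thm 4.1.5] -/
theorem norm_sq_ge_of_mem_ker_orthogonal {D : E →ₗ[ℝ] F} {e : OrthonormalBasis ι ℝ E} {a : ι → ℝ} (h : Frame.IsDiag D e a) {m : ℝ}
    (hdich : ∀ i, a i = 0 ∨ m ≤ a i) {q : E} (hq : q ∈ (LinearMap.ker D)ᗮ) : m * ‖q‖ ^ 2 ≤ ‖D q‖ ^ 2 := by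
  have hcoer := h.norm_sq_ge_of_dichotomy hdich q
  have hzero : ∑ i ∈ univ.filter (fun i => a i = 0), ⟪e i, q⟫_ℝ ^ 2 = 0 := by
    refine Finset.sum_eq_zero fun i hi => ?_
    have hi0 : a i = 0 := (Finset.mem_filter.mp hi).2
    have : ⟪e i, q⟫_ℝ = 0 := (Submodule.mem_orthogonal _ q).mp hq (e i) (frame_mem_ker_of_value_zero h hi0)
    rw [this]; ring
  rw [hzero, sub_zero] at hcoer
  exact hcoer

end Abstract

/-! ## §2 The stiff space at the vacuum and its coercivity -/

variable (L : ℕ) [NeZero L]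

/-- **The stiff space** of the `L³` torus at the classical vacuum: the orthogonal complement in `LinkSpace L` of the zero modes of the vacuum curl
`covCurl 1` (constants ⊕ linearised gauge modes). [cite: Luscher1983, §3] -/
def stiffSpace : Submodule ℝ (LinkSpace L) := (LinearMap.ker (covCurl (1 : GaugeConfig 3 L SU2)))ᗮ

variable {L}

/-- Membership: `q ∈ stiffSpace ↔ q ⟂ ker(covCurl 1)`. [folklore] -/
theorem mem_stiffSpace {q : LinkSpace L} : q ∈ stiffSpace L ↔ ∀ v : LinkSpace L, covCurl (1 : GaugeConfig 3 L SU2) v = 0 → ⟪v, q⟫_ℝ = 0 := by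
  unfold stiffSpace
  rw [Submodule.mem_orthogonal]
  simp only [LinearMap.mem_ker]

/-- ★★ **STIFF COERCIVITY AT THE VACUUM**: for `L ≥ 2` and `q ∈ stiffSpace L`, `(2 − 2cos(2π/L))·‖q‖² ≤ ‖covCurl 1 q‖²`. [cite: Luscher1983, §3] -/
theorem stiff_coercive (hL : 2 ≤ L) {q : LinkSpace L} (hq : q ∈ stiffSpace L) :
    (2 - 2 * Real.cos (2 * Real.pi / L)) * ‖q‖ ^ 2 ≤ ‖covCurl (1 : GaugeConfig 3 L SU2) q‖ ^ 2 := by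
  classical
  have h₀ := Frame.isDiag_gramEigenvectorBasis (covCurl (1 : GaugeConfig 3 L SU2))
  have hdich := fun j => Frame.IsDiag.value_zero_or_ge_vacuum L hL h₀ j
  exact norm_sq_ge_of_mem_ker_orthogonal h₀ hdich hq

/-- Hence a stiff vector killed by the vacuum curl is zero (`Stiff ∩ ker = 0`). [folklore] -/
theorem eq_zero_of_mem_stiff_of_covCurl_eq_zero (hL : 2 ≤ L) {q : LinkSpace L} (hq : q ∈ stiffSpace L)
    (h0 : covCurl (1 : GaugeConfig 3 L SU2) q = 0) : q = 0 := by
  have h := stiff_coercive hL hq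
  rw [h0, norm_zero] at h
  have hg := gap_pos L hL
  have hq2 : ‖q‖ ^ 2 ≤ 0 := by
    by_contra hcon
    push Not at hcon
    have := mul_pos hg hcon
    nlinarith
  have hn : ‖q‖ = 0 := by nlinarith [norm_nonneg q]
  exact norm_eq_zero.mp hn

/-! ## §3 The constant modes (and the linearised gauge modes) are zero modes of the vacuum curl -/

omit [NeZero L] in
/-- A constant mode is the direction-constant 1-form of its values at the origin. [folklore] -/
theorem eq_constForm_of_mem_constModes {v : LinkSpace L} (hv : v ∈ constModes L) :
    v = WithLp.toLp 2 (fun ea : Edge 3 L × Fin 3 => v (((0 : Site 3 L), ea.1.2), ea.2)) := by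
  ext ⟨⟨x, i⟩, a⟩
  exact apply_eq_of_mem_constModes L hv x 0 i a

omit [NeZero L] in
/-- ★ `constModes L ≤ ker(covCurl 1)`. [cite: Luscher1983, §3] -/
theorem constModes_le_ker_covCurl_one : constModes L ≤ LinearMap.ker (covCurl (1 : GaugeConfig 3 L SU2)) := by
  intro v hv
  rw [LinearMap.mem_ker, covCurl_one, eq_constForm_of_mem_constModes hv]
  exact latCurl_constMode L (fun i a => v (((0 : Site 3 L), i), a))

omit [NeZero L] in
/-- The linearised gauge mode of `φ : sites → ℝ³` is a zero mode of the vacuum curl. [cite: Luscher1983, §3] -/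
theorem gradient_mem_ker_covCurl_one (φ : Site 3 L → Fin 3 → ℝ) :
    (WithLp.toLp 2 fun ea : Edge 3 L × Fin 3 => φ (ea.1.1.shift ea.1.2) ea.2 - φ ea.1.1 ea.2) ∈ LinearMap.ker (covCurl (1 : GaugeConfig 3 L SU2)) := by
  rw [LinearMap.mem_ker, covCurl_one]
  exact latCurl_gradient L φ

/-- ★ Constant modes are orthogonal to the stiff space. [cite: Luscher1983, §3] -/
theorem inner_eq_zero_of_mem_constModes_of_mem_stiff {v q : LinkSpace L} (hv : v ∈ constModes L) (hq : q ∈ stiffSpace L) : ⟪v, q⟫_ℝ = 0 :=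
  (mem_stiffSpace.mp hq) v (LinearMap.mem_ker.mp (constModes_le_ker_covCurl_one hv))

/-- … and so are the linearised gauge modes. [cite: Luscher1983, §3] -/
theorem inner_gradient_eq_zero_of_mem_stiff (φ : Site 3 L → Fin 3 → ℝ) {q : LinkSpace L} (hq : q ∈ stiffSpace L) :
    ⟪(WithLp.toLp 2 fun ea : Edge 3 L × Fin 3 => φ (ea.1.1.shift ea.1.2) ea.2 - φ ea.1.1 ea.2 : LinkSpace L), q⟫_ℝ = 0 :=
  (mem_stiffSpace.mp hq) _ (LinearMap.mem_ker.mp (gradient_mem_ker_covCurl_one φ))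

/-- The three-way orthogonality used by the product chart: for `q ∈ stiffSpace`, `v ∈ constModes`: `‖v + q‖² = ‖v‖² + ‖q‖²`. [folklore] -/
theorem norm_add_sq_of_const_stiff {v q : LinkSpace L} (hv : v ∈ constModes L) (hq : q ∈ stiffSpace L) : ‖v + q‖ ^ 2 = ‖v‖ ^ 2 + ‖q‖ ^ 2 := by
  rw [norm_add_sq_real, inner_eq_zero_of_mem_constModes_of_mem_stiff hv hq, mul_zero, add_zero]

end Summit.QuantumFields.YangMills.Theorems.FemtoTransferGap.TwoLattice.Toron

end
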